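import Mathlib
import HarnessLib
import Literature.Analysis.Approximation.ChebyshevExtremaInterpolation
import Literature.Analysis.Approximation.ChebyshevExtremaClass
import Literature.Analysis.Approximation.FinitePointSetMinimax

/-!
# The Lebesgue function outside the interval (Rivlin, Ex. 2.7.10–2.7.11), `C_n ⊄ B_n`
# (Ex. 2.7.6) and Lepson's bound for `T_n'` (Ex. 2.7.5)

Source: T. J. Rivlin, *The Chebyshev Polynomials* (Wiley, 1974) [Rivlin1974], Sect. 2.7.4–2.7.5,
the extrapolation remark on p. 121, and Exercises 2.7.5, 2.7.6, 2.7.10, 2.7.11 (pp. 122–123).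

Let `X = {x_i}_{i ∈ s}` be distinct real nodes (`v : ι → ℝ` injective on `s`) with Lagrange
fundamental polynomials `ℓ_i = Lagrange.basis s v i`. The LEBESGUE FUNCTION of `X` is
`λ(X; t) = Σ_i |ℓ_i(t)|` (`lebesgueFunction`). Rivlin (p. 121): if `f` is sampled at the `x_i`
with errors `|ε_i| ≤ ε`, the error of the extrapolated value `p(t)` of the interpolant that is due
to the `ε_i` does not exceed `ε λ(X; t)` (`abs_eval_interpolate_add_sub_le`); more generally
`|p(t)| ≤ M λ(X; t)` for every `p` of degree `< #s` with `|p(x_i)| ≤ M`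
(`abs_eval_le_mul_lebesgueFunction`), and the bound is attained (`exists_eval_eq_lebesgueFunction`,
`isGreatest_lebesgueFunction`; this is Ex. 2.7.11 with `k = 0`: `max_{p ∈ V(X)} |p(t)| = λ(X; t)`
for `V(X) = {p ∈ 𝒫_n : |p(x_i)| ≤ 1}`).

Ex. 2.7.10: for `n + 1` nodes in `I = [-1, 1]`, `λ(X; t) ≥ |T_n(t)|` for every real `t`
(`abs_eval_T_le_lebesgueFunction`, from `T_n = Σ_i T_n(x_i) ℓ_i` and `|T_n(x_i)| ≤ 1`), while for
the extrema `U : η_j = cos (jπ/n)` (Mathlib's `Polynomial.Chebyshev.node n j`) and `|t| ≥ 1`,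
`λ(U; t) = |T_n(t)|` (`lebesgueFunction_node_eq`: beyond the nodes the `ℓ_j(t)` alternate in sign,
`neg_one_pow_mul_eval_basis_pos_of_lt` / `_of_gt`, so that
`Σ_j |ℓ_j(U; t)| = |Σ_j (-1)^j ℓ_j(U; t)| = |T_n(t)|`); hence `λ(U; t) ≤ λ(X; t)`
(`lebesgueFunction_node_le`), with equality at some `|t| > 1` only if `X = U`
(`image_eq_image_node_of_lebesgueFunction_eq`, `n ≥ 1`). Thus
`min_X max_{p ∈ V(X)} |p(t)| = |T_n(t)|`, attained at `X = U` (Ex. 2.7.11 for `k = 0`).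

Ex. 2.7.6: `C_n = V(U)` is not contained in `B_n = {p ∈ 𝒫_n : ‖p‖ ≤ 1}` for `n > 1`
(`exists_abs_eval_node_le_one_and_one_lt_eval`: the parabola `1 + h²/8 - (x - m)²/4` centred at
the midpoint `m` of `[η_1, η_0]`, `h` its half-length).

Ex. 2.7.5 (Lepson): with `R_k(t) = U_k(t/2)`, `|R_k(t)| ≤ t^{-k/3}` for `0 < t < 1`
(`abs_eval_U_half_le_rpow`, by the two-step recurrence `R_{k+3} = (t² - 1) R_{k+1} - t R_k`,
`U_add_three`), strictly for `k ≥ 1` (`abs_eval_U_half_lt_rpow`), whence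
`|T_n'(x)| = n |U_{n-1}(x)| < n / (2x)^{(n-1)/3}` for `0 < x < 1/2`, `n > 1`
(`abs_derivative_T_eval_lt`), improving (2.104) `|T_n'(x)| ≤ n / √(1 - x²)`
(`abs_derivative_T_eval_le_div_sqrt`, the case `p = T_n` of (2.69), here read off the tree's
`ChebyshevExtremaClass.one_sub_sq_mul_derivative_T_eval_sq_le`) near the origin.

Not formalised here: Ex. 2.7.10/2.7.11 for derivatives `k ≥ 1` and Berman's (2.102) (they rest
on Duffin–Schaeffer's Theorem 2.24), Ex. 2.7.7–2.7.9 and 2.7.12–2.7.13. Related tree material: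
`ChebyshevExtremaInterpolation` (interpolation at `U`), `FinitePointSetMinimax` (the sign pattern
of the nodal weights, `neg_one_pow_mul_nodalWeight_pos`), Mathlib's
`Polynomial.Chebyshev.sumNodes` lemmas (growth of `p ∈ B_n` outside `I`, (2.37)) and
`Literature.Combinatorics.Optimization.ChebyshevDesign` (one explicit extrapolation design with
`Σ_j |ℓ_j(0)| ≤ 20` for quadratically spaced nodes; unrelated to the minimality of `U`).
-/

open Polynomial Polynomial.Chebyshev Real Finset Lagrange

namespace Literature.Analysis.Approximation.ExtrapolationLebesgueFunction

open Literature.Analysis.Approximation.ChebyshevExtremaInterpolation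
open Literature.Analysis.Approximation.ChebyshevExtremaClass
open Literature.Analysis.Approximation.FinitePointSetMinimax

variable {ι : Type*} [DecidableEq ι] (s : Finset ι) (v : ι → ℝ)

/-! ## The Lebesgue function of a node set -/

/-- The Lebesgue function `λ(X; t) = Σ_i |ℓ_i(X; t)|` of the nodes `X = v(s)`.
[cite: Rivlin1974, Sect. 2.7.5 (2.101) with k = 0, p. 121 and Sect. 1.3 (1.32)] -/
noncomputable def lebesgueFunction (t : ℝ) : ℝ := ∑ i ∈ s, |(Lagrange.basis s v i).eval t|

/-- `λ(X; t) ≥ 0`. [cite: Rivlin1974, p. 121] -/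
theorem lebesgueFunction_nonneg (t : ℝ) : 0 ≤ lebesgueFunction s v t :=
  sum_nonneg fun _ _ => abs_nonneg _

/-- `(basisDivisor x y)(t) = (t - y)/(x - y)`. [cite: Rivlin1974, Sect. 1.3 (1.20)] -/
theorem eval_basisDivisor (x y t : ℝ) : (basisDivisor x y).eval t = (x - y)⁻¹ * (t - y) := by
  simp [basisDivisor]

/-- `ℓ_i(t) = w_i ∏_{j ≠ i} (t - x_j)` with the nodal weight `w_i = ∏_{j ≠ i} (x_i - x_j)⁻¹`.
[cite: Rivlin1974, Sect. 1.3 (1.20)-(1.22)] -/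
theorem eval_basis_eq_nodalWeight_mul_prod (i : ι) (t : ℝ) :
    (Lagrange.basis s v i).eval t = nodalWeight s v i * ∏ j ∈ s.erase i, (t - v j) := by
  rw [Lagrange.basis, eval_prod, nodalWeight, ← prod_mul_distrib]
  exact prod_congr rfl fun j _ => eval_basisDivisor _ _ _

/-- `ℓ_i(t) ≠ 0` off the nodes. [cite: Rivlin1974, Sect. 1.3 (1.20)] -/
theorem eval_basis_ne_zero (hvs : Set.InjOn v s) {i : ι} (hi : i ∈ s) {t : ℝ}
    (ht : ∀ j ∈ s, t ≠ v j) : (Lagrange.basis s v i).eval t ≠ 0 := by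
  rw [eval_basis_eq_nodalWeight_mul_prod]
  exact mul_ne_zero (nodalWeight_ne_zero hvs hi)
    (prod_ne_zero_iff.2 fun j hj => sub_ne_zero.2 (ht j (mem_of_mem_erase hj)))

/-- `L(r, X; t) = Σ_i r_i ℓ_i(t)` at an arbitrary point. [cite: Rivlin1974, Sect. 1.3 (1.19)] -/
theorem eval_interpolate (r : ι → ℝ) (t : ℝ) :
    (interpolate s v r).eval t = ∑ i ∈ s, r i * (Lagrange.basis s v i).eval t := by
  rw [interpolate_apply, eval_finsetSum]
  exact sum_congr rfl fun i _ => by rw [eval_mul, eval_C]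

/-- `|p(t)| ≤ Σ_i |p(x_i)| |ℓ_i(t)|` for `deg p < #s`.
[cite: Rivlin1974, p. 121; Ex. 2.7.10 (hint)] -/
theorem abs_eval_le_sum_abs_mul (hvs : Set.InjOn v s) {p : ℝ[X]} (hp : p.degree < #s) (t : ℝ) :
    |p.eval t| ≤ ∑ i ∈ s, |p.eval (v i)| * |(Lagrange.basis s v i).eval t| := by
  have h := eq_interpolate hvs hp
  calc |p.eval t| = |∑ i ∈ s, p.eval (v i) * (Lagrange.basis s v i).eval t| := by
        conv_lhs => rw [h]
        rw [eval_interpolate]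
    _ ≤ ∑ i ∈ s, |p.eval (v i) * (Lagrange.basis s v i).eval t| := abs_sum_le_sum_abs _ _
    _ = ∑ i ∈ s, |p.eval (v i)| * |(Lagrange.basis s v i).eval t| := by simp_rw [abs_mul]

/-- `|p(t)| ≤ M λ(X; t)` whenever `deg p < #s` and `|p(x_i)| ≤ M` at the nodes.
[cite: Rivlin1974, p. 121; Ex. 2.7.11 (k = 0)] -/
theorem abs_eval_le_mul_lebesgueFunction (hvs : Set.InjOn v s) {p : ℝ[X]} (hp : p.degree < #s)
    {M : ℝ} (hM : ∀ i ∈ s, |p.eval (v i)| ≤ M) (t : ℝ) :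
    |p.eval t| ≤ M * lebesgueFunction s v t := by
  refine (abs_eval_le_sum_abs_mul s v hvs hp t).trans ?_
  rw [lebesgueFunction, mul_sum]
  exact sum_le_sum fun i hi => mul_le_mul_of_nonneg_right (hM i hi) (abs_nonneg _)

/-- `|L(r, X; t)| ≤ M λ(X; t)` when `|r_i| ≤ M`. [cite: Rivlin1974, p. 121] -/
theorem abs_eval_interpolate_le_mul_lebesgueFunction (hvs : Set.InjOn v s) (r : ι → ℝ) {M : ℝ}
    (hM : ∀ i ∈ s, |r i| ≤ M) (t : ℝ) :
    |(interpolate s v r).eval t| ≤ M * lebesgueFunction s v t := by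
  refine abs_eval_le_mul_lebesgueFunction s v hvs (degree_interpolate_lt _ hvs) (fun i hi => ?_) t
  rw [eval_interpolate_at_node _ hvs hi]
  exact hM i hi

/-- Extrapolation error (p. 121): if the data `f_i` carry errors `ε_i` with `|ε_i| ≤ ε`, the value
of the interpolant at `t` changes by at most `ε λ(X; t)`. [cite: Rivlin1974, p. 121] -/
theorem abs_eval_interpolate_add_sub_le (hvs : Set.InjOn v s) (f e : ι → ℝ) {ε : ℝ}
    (he : ∀ i ∈ s, |e i| ≤ ε) (t : ℝ) :
    |(interpolate s v (f + e)).eval t - (interpolate s v f).eval t| ≤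
      ε * lebesgueFunction s v t := by
  rw [map_add, eval_add, add_sub_cancel_left]
  exact abs_eval_interpolate_le_mul_lebesgueFunction s v hvs e he t

/-- `λ(X; t) ≥ 1` (from `Σ_i ℓ_i = 1`). [cite: Rivlin1974, Sect. 1.3 (1.33)] -/
theorem one_le_lebesgueFunction (hvs : Set.InjOn v s) (hs : s.Nonempty) (t : ℝ) :
    1 ≤ lebesgueFunction s v t := by
  have h := sum_basis hvs hs
  calc (1 : ℝ) = |(∑ i ∈ s, Lagrange.basis s v i).eval t| := by rw [h, eval_one, abs_one]
    _ = |∑ i ∈ s, (Lagrange.basis s v i).eval t| := by rw [eval_finsetSum]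
    _ ≤ lebesgueFunction s v t := abs_sum_le_sum_abs _ _

/-- `λ(X; x_i) = 1` at a node. [cite: Rivlin1974, Sect. 1.3 (1.21)] -/
theorem lebesgueFunction_node_self (hvs : Set.InjOn v s) {i : ι} (hi : i ∈ s) :
    lebesgueFunction s v (v i) = 1 := by
  rw [lebesgueFunction, ← add_sum_erase _ _ hi, eval_basis_self hvs hi, abs_one, add_eq_left]
  exact sum_eq_zero fun j hj => by rw [eval_basis_of_ne (mem_erase.1 hj).1 hi, abs_zero]

/-- The bound `λ(X; t)` is attained by `p = Σ_i sgn(ℓ_i(t)) ℓ_i ∈ V(X)`.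
[cite: Rivlin1974, Ex. 2.7.11 (k = 0); Sect. 2.7.5 (2.101)] -/
theorem exists_eval_eq_lebesgueFunction (hvs : Set.InjOn v s) (t : ℝ) :
    ∃ p : ℝ[X], p.degree < #s ∧ (∀ i ∈ s, |p.eval (v i)| ≤ 1) ∧
      p.eval t = lebesgueFunction s v t := by
  classical
  let σ : ι → ℝ := fun i => if 0 ≤ (Lagrange.basis s v i).eval t then 1 else -1
  refine ⟨interpolate s v σ, degree_interpolate_lt _ hvs, fun i hi => ?_, ?_⟩
  · rw [eval_interpolate_at_node _ hvs hi]
    simp only [σ]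
    split_ifs <;> simp
  · rw [eval_interpolate, lebesgueFunction]
    refine sum_congr rfl fun i _ => ?_
    simp only [σ]
    split_ifs with h
    · rw [one_mul, abs_of_nonneg h]
    · rw [neg_one_mul, abs_of_neg (lt_of_not_ge h)]

/-- Ex. 2.7.11 with `k = 0`: `max {|p(t)| : deg p ≤ n, |p(x_i)| ≤ 1} = λ(X; t)`.
[cite: Rivlin1974, Ex. 2.7.11 (k = 0); Sect. 2.7.5 (2.101)] -/
theorem isGreatest_lebesgueFunction (hvs : Set.InjOn v s) (t : ℝ) :
    IsGreatest {y : ℝ | ∃ p : ℝ[X], p.degree < #s ∧ (∀ i ∈ s, |p.eval (v i)| ≤ 1) ∧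
      y = |p.eval t|} (lebesgueFunction s v t) := by
  refine ⟨?_, ?_⟩
  · obtain ⟨p, hp, hb, he⟩ := exists_eval_eq_lebesgueFunction s v hvs t
    exact ⟨p, hp, hb, by rw [he, abs_of_nonneg (lebesgueFunction_nonneg s v t)]⟩
  · rintro y ⟨p, hp, hb, rfl⟩
    simpa using abs_eval_le_mul_lebesgueFunction s v hvs hp hb t

/-! ## Ex. 2.7.10: the extrema of `T_n` minimise the Lebesgue function outside the interval -/

/-- The lower bound of Ex. 2.7.10: `|T_n(t)| ≤ λ(X; t)` for `n + 1` nodes in `I` and every real `t`.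
[cite: Rivlin1974, Ex. 2.7.10 (hint)] -/
theorem abs_eval_T_le_lebesgueFunction (hvs : Set.InjOn v s) {n : ℕ} (hn : #s = n + 1)
    (hI : ∀ i ∈ s, v i ∈ Set.Icc (-1 : ℝ) 1) (t : ℝ) :
    |(T ℝ n).eval t| ≤ lebesgueFunction s v t := by
  have hdeg : (T ℝ n).degree < #s := by
    rw [degree_T, Int.natAbs_natCast, hn]
    exact_mod_cast n.lt_succ_self
  simpa using abs_eval_le_mul_lebesgueFunction s v hvs hdeg
    (fun i hi => abs_eval_T_real_le_one _ (abs_le.2 ⟨(hI i hi).1, (hI i hi).2⟩)) t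

/-- To the right of all nodes `x_0 > x_1 > ⋯ > x_{N-1}`, `(-1)^i ℓ_i(t) > 0`.
[cite: Rivlin1974, Ex. 2.7.10 (hint); Sect. 2.3 (2.22)] -/
theorem neg_one_pow_mul_eval_basis_pos_of_lt {N : ℕ} {x : ℕ → ℝ} (hx : StrictAntiOn x (range N))
    {i : ℕ} (hi : i < N) {t : ℝ} (ht : ∀ j < N, x j < t) :
    0 < (-1) ^ i * (Lagrange.basis (range N) x i).eval t := by
  rw [eval_basis_eq_nodalWeight_mul_prod, ← mul_assoc]
  exact mul_pos (neg_one_pow_mul_nodalWeight_pos hx hi)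
    (prod_pos fun j hj => sub_pos.2 (ht j (mem_range.1 (mem_of_mem_erase hj))))

/-- To the left of all nodes, `(-1)^(N-1) (-1)^i ℓ_i(t) > 0`.
[cite: Rivlin1974, Ex. 2.7.10 (hint); Sect. 2.3 (2.22)] -/
theorem neg_one_pow_mul_eval_basis_pos_of_gt {N : ℕ} {x : ℕ → ℝ} (hx : StrictAntiOn x (range N))
    {i : ℕ} (hi : i < N) {t : ℝ} (ht : ∀ j < N, t < x j) :
    0 < (-1) ^ (N - 1) * ((-1) ^ i * (Lagrange.basis (range N) x i).eval t) := by
  have hcard : #((range N).erase i) = N - 1 := by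
    rw [card_erase_of_mem (mem_range.2 hi), card_range]
  have hprod : (-1 : ℝ) ^ (N - 1) * ∏ j ∈ (range N).erase i, (t - x j) =
      ∏ j ∈ (range N).erase i, (x j - t) := by
    rw [← hcard, ← prod_const, ← prod_mul_distrib]
    exact prod_congr rfl fun j _ => by ring
  rw [eval_basis_eq_nodalWeight_mul_prod,
    show ∀ a b c d : ℝ, a * (b * (c * d)) = (b * c) * (a * d) from fun a b c d => by ring, hprod]
  exact mul_pos (neg_one_pow_mul_nodalWeight_pos hx hi)
    (prod_pos fun j hj => sub_pos.2 (ht j (mem_range.1 (mem_of_mem_erase hj))))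

/-- Right of the nodes, `λ(X; t) = Σ_i (-1)^i ℓ_i(t)`. [cite: Rivlin1974, Ex. 2.7.10 (hint)] -/
theorem lebesgueFunction_eq_sum_of_lt {N : ℕ} {x : ℕ → ℝ} (hx : StrictAntiOn x (range N))
    {t : ℝ} (ht : ∀ j < N, x j < t) :
    lebesgueFunction (range N) x t =
      ∑ i ∈ range N, (-1) ^ i * (Lagrange.basis (range N) x i).eval t := by
  refine sum_congr rfl fun i hi => ?_
  have h := neg_one_pow_mul_eval_basis_pos_of_lt hx (mem_range.1 hi) ht
  rw [← abs_of_pos h, abs_mul, abs_neg_one_pow, one_mul]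

/-- Left of the nodes, `λ(X; t) = (-1)^(N-1) Σ_i (-1)^i ℓ_i(t)`.
[cite: Rivlin1974, Ex. 2.7.10 (hint)] -/
theorem lebesgueFunction_eq_sum_of_gt {N : ℕ} {x : ℕ → ℝ} (hx : StrictAntiOn x (range N))
    {t : ℝ} (ht : ∀ j < N, t < x j) :
    lebesgueFunction (range N) x t =
      (-1) ^ (N - 1) * ∑ i ∈ range N, (-1) ^ i * (Lagrange.basis (range N) x i).eval t := by
  rw [lebesgueFunction, mul_sum]
  refine sum_congr rfl fun i hi => ?_
  have h := neg_one_pow_mul_eval_basis_pos_of_gt hx (mem_range.1 hi) ht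
  rw [← abs_of_pos h, abs_mul, abs_mul, abs_neg_one_pow, abs_neg_one_pow, one_mul, one_mul]

/-- Beyond the nodes (on either side), `λ(X; t) = |L(((-1)^i)_i, X; t)|`: the Lebesgue function is
the absolute value of the interpolant of the alternating data.
[cite: Rivlin1974, Ex. 2.7.10 (hint)] -/
theorem lebesgueFunction_eq_abs_eval_interpolate {N : ℕ} {x : ℕ → ℝ}
    (hx : StrictAntiOn x (range N)) {t : ℝ} (ht : (∀ j < N, x j < t) ∨ (∀ j < N, t < x j)) :
    lebesgueFunction (range N) x t =
      |(interpolate (range N) x (fun i => (-1 : ℝ) ^ i)).eval t| := by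
  rw [eval_interpolate]
  rcases ht with ht | ht
  · rw [← lebesgueFunction_eq_sum_of_lt hx ht, abs_of_nonneg (lebesgueFunction_nonneg _ _ _)]
  · have h := lebesgueFunction_eq_sum_of_gt hx ht
    have h2 : ∑ i ∈ range N, (-1) ^ i * (Lagrange.basis (range N) x i).eval t =
        (-1) ^ (N - 1) * lebesgueFunction (range N) x t := by
      rw [h, ← mul_assoc, ← mul_pow, neg_one_mul, neg_neg, one_pow, one_mul]
    rw [h2, abs_mul, abs_neg_one_pow, one_mul, abs_of_nonneg (lebesgueFunction_nonneg _ _ _)]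

/-- `T_n` is the interpolant of the alternating data `(-1)^j` at the extrema `η_j`.
[cite: Rivlin1974, Sect. 1.2 (1.8); Ex. 2.7.10 (hint)] -/
theorem interpolate_node_neg_one_pow (n : ℕ) :
    interpolate (range (n + 1)) (node n) (fun j => (-1 : ℝ) ^ j) = T ℝ n := by
  have hdeg : (T ℝ n).degree < #(range (n + 1)) := by
    rw [degree_T, Int.natAbs_natCast, card_range]
    exact_mod_cast n.lt_succ_self
  conv_rhs => rw [eq_interpolate (injOn_node n) hdeg]
  exact interpolate_eq_of_values_eq_on _ _ fun j hj =>
    (eval_T_real_node (Finset.mem_Iic.2 (mem_range_succ_iff.1 hj))).symm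

/-- Ex. 2.7.10, the value at `U`: `λ(U; t) = |T_n(t)|` for `|t| ≥ 1`.
[cite: Rivlin1974, Ex. 2.7.10 (hint)] -/
theorem lebesgueFunction_node_eq (n : ℕ) {t : ℝ} (ht : 1 ≤ |t|) :
    lebesgueFunction (range (n + 1)) (node n) t = |(T ℝ n).eval t| := by
  rcases ht.lt_or_eq with ht | ht
  · rw [← interpolate_node_neg_one_pow n]
    refine lebesgueFunction_eq_abs_eval_interpolate (strictAntiOn_node n) ?_
    rcases le_or_gt 0 t with h0 | h0
    · left
      intro j _
      rw [abs_of_nonneg h0] at ht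
      exact (node_mem_Icc.2).trans_lt ht
    · right
      intro j _
      rw [abs_of_neg h0] at ht
      exact (show t < -1 by linarith).trans_le node_mem_Icc.1
  · rcases (abs_eq zero_le_one).1 ht.symm with h1 | h1
    · rw [h1, show (1 : ℝ) = node n 0 from node_eq_one.symm,
        lebesgueFunction_node_self _ _ (injOn_node n) (mem_range.2 n.succ_pos),
        eval_T_real_node (Finset.mem_Iic.2 (Nat.zero_le n)), pow_zero, abs_one]
    · rcases eq_or_ne n 0 with rfl | hn
      · rw [h1, lebesgueFunction, Finset.range_one, sum_singleton, basis_singleton, eval_one,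
          abs_one]
        simp
      · rw [h1, show (-1 : ℝ) = node n n from (node_eq_neg_one hn).symm,
          lebesgueFunction_node_self _ _ (injOn_node n) (mem_range.2 n.lt_succ_self),
          eval_T_real_node (Finset.mem_Iic.2 le_rfl), abs_neg_one_pow]

/-- Ex. 2.7.10 (D. L. Berman for `k = 0`): `λ(U; t) ≤ λ(X; t)` for `|t| ≥ 1` and every set `X` of
`n + 1` nodes in `I`. [cite: Rivlin1974, Ex. 2.7.10; Sect. 2.7.5 (2.102)] -/
theorem lebesgueFunction_node_le (hvs : Set.InjOn v s) {n : ℕ} (hn : #s = n + 1)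
    (hI : ∀ i ∈ s, v i ∈ Set.Icc (-1 : ℝ) 1) {t : ℝ} (ht : 1 ≤ |t|) :
    lebesgueFunction (range (n + 1)) (node n) t ≤ lebesgueFunction s v t := by
  rw [lebesgueFunction_node_eq n ht]
  exact abs_eval_T_le_lebesgueFunction s v hvs hn hI t

omit [DecidableEq ι] in
/-- `n + 1` distinct points of `I` (`n ≥ 1`) at which `|T_n| = 1` are exactly the extrema `η_j`.
[cite: Rivlin1974, Sect. 1.2; Ex. 2.7.10] -/
theorem image_eq_image_node_of_abs_eval_T_eq_one (hvs : Set.InjOn v s) {n : ℕ} (hn0 : n ≠ 0)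
    (hn : #s = n + 1) (h1 : ∀ i ∈ s, |(T ℝ n).eval (v i)| = 1) :
    s.image v = (range (n + 1)).image (node n) := by
  have hsub : s.image v ⊆ (range (n + 1)).image (node n) := by
    intro y hy
    obtain ⟨i, hi, rfl⟩ := mem_image.1 hy
    obtain ⟨j, hj, hji⟩ := (abs_eval_T_real_eq_one_iff (by exact_mod_cast hn0) (v i)).1 (h1 i hi)
    exact mem_image.2 ⟨j, mem_range.2 (Nat.lt_succ_of_le hj), by rw [node_eq_cos, hji]⟩
  refine eq_of_subset_of_card_le hsub ?_
  calc #((range (n + 1)).image (node n)) ≤ #(range (n + 1)) := card_image_le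
    _ = #s := by rw [card_range, hn]
    _ = #(s.image v) := (card_image_of_injOn hvs).symm

/-- Ex. 2.7.10, equality: if `λ(X; t) = |T_n(t)|` for some `|t| > 1` (`n ≥ 1`, nodes in `I`), then
`X = U`. [cite: Rivlin1974, Ex. 2.7.10] -/
theorem image_eq_image_node_of_lebesgueFunction_eq (hvs : Set.InjOn v s) {n : ℕ} (hn0 : n ≠ 0)
    (hn : #s = n + 1) (hI : ∀ i ∈ s, v i ∈ Set.Icc (-1 : ℝ) 1) {t : ℝ} (ht : 1 < |t|)
    (heq : lebesgueFunction s v t = |(T ℝ n).eval t|) :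
    s.image v = (range (n + 1)).image (node n) := by
  have hne : ∀ j ∈ s, t ≠ v j := by
    intro j hj h
    have := abs_le.2 ⟨(hI j hj).1, (hI j hj).2⟩
    rw [← h] at this
    linarith
  have hdeg : (T ℝ n).degree < #s := by
    rw [degree_T, Int.natAbs_natCast, hn]
    exact_mod_cast n.lt_succ_self
  have hle : ∀ i ∈ s, |(T ℝ n).eval (v i)| * |(Lagrange.basis s v i).eval t| ≤
      |(Lagrange.basis s v i).eval t| := fun i hi =>
    mul_le_of_le_one_left (abs_nonneg _)
      (abs_eval_T_real_le_one _ (abs_le.2 ⟨(hI i hi).1, (hI i hi).2⟩))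
  have hsum : ∑ i ∈ s, |(T ℝ n).eval (v i)| * |(Lagrange.basis s v i).eval t| =
      ∑ i ∈ s, |(Lagrange.basis s v i).eval t| :=
    le_antisymm (sum_le_sum hle)
      (by
        rw [← lebesgueFunction, heq]
        exact abs_eval_le_sum_abs_mul s v hvs hdeg t)
  have h1 : ∀ i ∈ s, |(T ℝ n).eval (v i)| = 1 := by
    intro i hi
    have h := (sum_eq_sum_iff_of_le hle).1 hsum i hi
    exact (mul_eq_right₀ (abs_ne_zero.2 (eval_basis_ne_zero s v hvs hi hne))).1 h
  exact image_eq_image_node_of_abs_eval_T_eq_one s v hvs hn0 hn h1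

/-! ## Ex. 2.7.6: `C_n ⊄ B_n` -/

/-- Ex. 2.7.6: for `n > 1` there is `p ∈ 𝒫_n` with `|p(η_j)| ≤ 1` at all the extrema of `T_n` but
`‖p‖ > 1` on `I`: `C_n ⊄ B_n`. [cite: Rivlin1974, Ex. 2.7.6] -/
theorem exists_abs_eval_node_le_one_and_one_lt_eval {n : ℕ} (hn : 2 ≤ n) :
    ∃ p : ℝ[X], p.natDegree ≤ n ∧ (∀ j ≤ n, |p.eval (node n j)| ≤ 1) ∧
      ∃ x ∈ Set.Icc (-1 : ℝ) 1, 1 < p.eval x := by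
  have hc1 : node n 1 < 1 := by
    rw [← node_eq_one (n := n)]
    exact node_lt (by omega) zero_lt_one
  have hcI : -1 ≤ node n 1 := node_mem_Icc.1
  refine ⟨Polynomial.C (1 + ((1 - node n 1) / 2) ^ 2 / 8) -
      Polynomial.C (1 / 4) * (X - Polynomial.C ((1 + node n 1) / 2)) ^ 2, ?_, ?_, ?_⟩
  · refine (natDegree_sub_le _ _).trans (max_le ?_ ?_)
    · rw [natDegree_C]
      exact Nat.zero_le _
    · refine (natDegree_C_mul_le _ _).trans ?_
      calc ((X - Polynomial.C ((1 + node n 1) / 2)) ^ 2).natDegree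
          ≤ 2 * (X - Polynomial.C ((1 + node n 1) / 2)).natDegree := natDegree_pow_le
        _ = 2 := by rw [natDegree_X_sub_C, mul_one]
        _ ≤ n := hn
  · intro j hj
    have hjI : node n j ∈ Set.Icc (-1 : ℝ) 1 := node_mem_Icc
    have hd : ((1 - node n 1) / 2) ^ 2 ≤ (node n j - (1 + node n 1) / 2) ^ 2 := by
      rcases Nat.eq_zero_or_pos j with rfl | hj0
      · rw [node_eq_one]
        nlinarith
      · have hle : node n j ≤ node n 1 := by
          rcases (Nat.succ_le_of_lt hj0).eq_or_lt with h | h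
          · rw [← h]
          · exact (node_lt hj h).le
        nlinarith
    have hd2 : (node n j - (1 + node n 1) / 2) ^ 2 ≤ 4 := by
      nlinarith [hjI.1, hjI.2]
    simp only [eval_sub, eval_mul, eval_C, eval_pow, eval_X]
    rw [abs_le]
    constructor <;> nlinarith
  · refine ⟨(1 + node n 1) / 2, ⟨by linarith, by linarith⟩, ?_⟩
    simp only [eval_sub, eval_mul, eval_C, eval_pow, eval_X, sub_self]
    have : 0 < ((1 - node n 1) / 2) ^ 2 := by
      have : 0 < (1 - node n 1) / 2 := by linarith
      positivity
    nlinarith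

/-! ## Ex. 2.7.5: Lepson's bound for `T_n'` near the origin -/

/-- The two-step recurrence `U_{k+3} = (4x² - 1) U_{k+1} - 2x U_k`.
[cite: Rivlin1974, Ex. 2.7.5 (hint), Ex. 1.5.19] -/
theorem U_add_three (n : ℤ) :
    U ℝ (n + 3) = (4 * X ^ 2 - 1) * U ℝ (n + 1) - 2 * X * U ℝ n := by
  have h1 := U_add_two ℝ (n + 1)
  have h2 := U_add_two ℝ n
  rw [show n + 3 = n + 1 + 2 by ring, h1, show n + 1 + 1 = n + 2 by ring, h2]
  ring

/-- `R_{k+3}(t) = (t² - 1) R_{k+1}(t) - t R_k(t)` for `R_k(t) = U_k(t/2)`.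
[cite: Rivlin1974, Ex. 2.7.5 (hint), Ex. 1.5.19] -/
theorem eval_U_half_add_three (k : ℕ) (t : ℝ) :
    (U ℝ ((k + 3 : ℕ) : ℤ)).eval (t / 2) =
      (t ^ 2 - 1) * (U ℝ ((k + 1 : ℕ) : ℤ)).eval (t / 2) - t * (U ℝ (k : ℤ)).eval (t / 2) := by
  push_cast
  rw [U_add_three]
  simp only [eval_sub, eval_mul, eval_pow, eval_X, eval_ofNat, eval_one]
  ring

/-- The inductive step of Lepson's estimate: from `|R_k| ≤ t^{-k/3}` and `|R_{k+1}| ≤ t^{-(k+1)/3}`,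
`|R_{k+3}(t)| ≤ t^{-(k+3)/3} ((1 - t²) t^{2/3} + t²)`. [cite: Rivlin1974, Ex. 2.7.5 (hint)] -/
theorem abs_eval_U_half_add_three_le (k : ℕ) {t : ℝ} (ht0 : 0 < t) (ht1 : t < 1)
    (hk : |(U ℝ (k : ℤ)).eval (t / 2)| ≤ t ^ (-(k : ℝ) / 3))
    (hk1 : |(U ℝ ((k + 1 : ℕ) : ℤ)).eval (t / 2)| ≤ t ^ (-((k + 1 : ℕ) : ℝ) / 3)) :
    |(U ℝ ((k + 3 : ℕ) : ℤ)).eval (t / 2)| ≤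
      t ^ (-((k + 3 : ℕ) : ℝ) / 3) * ((1 - t ^ 2) * t ^ (2 / 3 : ℝ) + t ^ 2) := by
  have e1 : t ^ (-((k + 1 : ℕ) : ℝ) / 3) = t ^ (-((k + 3 : ℕ) : ℝ) / 3) * t ^ (2 / 3 : ℝ) := by
    rw [← rpow_add ht0]
    congr 1
    push_cast
    ring
  have e2 : t * t ^ (-(k : ℝ) / 3) = t ^ (-((k + 3 : ℕ) : ℝ) / 3) * t ^ 2 := by
    rw [← rpow_two, ← rpow_add ht0,
      show -((k + 3 : ℕ) : ℝ) / 3 + 2 = 1 + -(k : ℝ) / 3 by push_cast; ring, rpow_add ht0, rpow_one]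
  have ht2 : 0 ≤ 1 - t ^ 2 := by nlinarith
  rw [eval_U_half_add_three]
  calc |(t ^ 2 - 1) * (U ℝ ((k + 1 : ℕ) : ℤ)).eval (t / 2) - t * (U ℝ (k : ℤ)).eval (t / 2)|
      ≤ |(t ^ 2 - 1) * (U ℝ ((k + 1 : ℕ) : ℤ)).eval (t / 2)| + |t * (U ℝ (k : ℤ)).eval (t / 2)| :=
        abs_sub _ _
    _ = (1 - t ^ 2) * |(U ℝ ((k + 1 : ℕ) : ℤ)).eval (t / 2)| +
          t * |(U ℝ (k : ℤ)).eval (t / 2)| := by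
        rw [abs_mul, abs_mul, abs_of_pos ht0, abs_sub_comm, abs_of_nonneg ht2]
    _ ≤ (1 - t ^ 2) * t ^ (-((k + 1 : ℕ) : ℝ) / 3) + t * t ^ (-(k : ℝ) / 3) := by
        gcongr
    _ = t ^ (-((k + 3 : ℕ) : ℝ) / 3) * ((1 - t ^ 2) * t ^ (2 / 3 : ℝ) + t ^ 2) := by
        rw [e1, e2]
        ring

/-- Lepson: `|U_k(t/2)| ≤ t^{-k/3}` for `0 < t < 1`. [cite: Rivlin1974, Ex. 2.7.5 (hint)] -/
theorem abs_eval_U_half_le_rpow (k : ℕ) {t : ℝ} (ht0 : 0 < t) (ht1 : t < 1) :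
    |(U ℝ (k : ℤ)).eval (t / 2)| ≤ t ^ (-(k : ℝ) / 3) := by
  induction k using Nat.strong_induction_on with
  | _ k ih =>
    rcases k with _ | _ | _ | k
    · simp
    · have h : (1 : ℝ) ≤ t ^ (-((0 + 1 : ℕ) : ℝ) / 3) :=
        one_le_rpow_of_pos_of_le_one_of_nonpos ht0 ht1.le (by norm_num)
      have he : (U ℝ ((0 + 1 : ℕ) : ℤ)).eval (t / 2) = t := by
        simp [U_one]
        ring
      rw [he, abs_of_pos ht0]
      exact ht1.le.trans h
    · have h : (1 : ℝ) ≤ t ^ (-((0 + 1 + 1 : ℕ) : ℝ) / 3) :=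
        one_le_rpow_of_pos_of_le_one_of_nonpos ht0 ht1.le (by norm_num)
      have he : (U ℝ ((0 + 1 + 1 : ℕ) : ℤ)).eval (t / 2) = t ^ 2 - 1 := by
        simp [U_two]
        ring
      rw [he, abs_sub_comm, abs_of_nonneg (by nlinarith)]
      exact le_trans (by nlinarith) h
    · have hk := ih k (by omega)
      have hk1 := ih (k + 1) (by omega)
      refine (abs_eval_U_half_add_three_le k ht0 ht1 hk hk1).trans ?_
      have hfac : (1 - t ^ 2) * t ^ (2 / 3 : ℝ) + t ^ 2 ≤ 1 := by
        have h23 : t ^ (2 / 3 : ℝ) ≤ 1 := rpow_le_one ht0.le ht1.le (by norm_num)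
        have ht2 : 0 ≤ 1 - t ^ 2 := by nlinarith
        nlinarith [mul_nonneg ht2 (sub_nonneg.2 h23)]
      exact mul_le_of_le_one_right (rpow_nonneg ht0.le _) hfac

/-- Lepson, strict form: `|U_k(t/2)| < t^{-k/3}` for `0 < t < 1` and `k ≥ 1`.
[cite: Rivlin1974, Ex. 2.7.5] -/
theorem abs_eval_U_half_lt_rpow {k : ℕ} (hk : k ≠ 0) {t : ℝ} (ht0 : 0 < t) (ht1 : t < 1) :
    |(U ℝ (k : ℤ)).eval (t / 2)| < t ^ (-(k : ℝ) / 3) := by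
  rcases k with _ | _ | _ | k
  · exact absurd rfl hk
  · have h : (1 : ℝ) ≤ t ^ (-((0 + 1 : ℕ) : ℝ) / 3) :=
      one_le_rpow_of_pos_of_le_one_of_nonpos ht0 ht1.le (by norm_num)
    have he : (U ℝ ((0 + 1 : ℕ) : ℤ)).eval (t / 2) = t := by
      simp [U_one]
      ring
    rw [he, abs_of_pos ht0]
    exact ht1.trans_le h
  · have h : (1 : ℝ) ≤ t ^ (-((0 + 1 + 1 : ℕ) : ℝ) / 3) :=
      one_le_rpow_of_pos_of_le_one_of_nonpos ht0 ht1.le (by norm_num)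
    have he : (U ℝ ((0 + 1 + 1 : ℕ) : ℤ)).eval (t / 2) = t ^ 2 - 1 := by
      simp [U_two]
      ring
    rw [he, abs_sub_comm, abs_of_nonneg (by nlinarith)]
    exact lt_of_lt_of_le (by nlinarith) h
  · refine (abs_eval_U_half_add_three_le k ht0 ht1 (abs_eval_U_half_le_rpow k ht0 ht1)
      (abs_eval_U_half_le_rpow (k + 1) ht0 ht1)).trans_lt ?_
    have hfac : (1 - t ^ 2) * t ^ (2 / 3 : ℝ) + t ^ 2 < 1 := by
      have h23 : t ^ (2 / 3 : ℝ) < 1 := rpow_lt_one ht0.le ht1 (by norm_num)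
      have ht2 : 0 < 1 - t ^ 2 := by nlinarith
      nlinarith [mul_pos ht2 (sub_pos.2 h23)]
    exact mul_lt_of_lt_one_right (rpow_pos_of_pos ht0 _) hfac

/-- (2.104): `|T_n'(x)| ≤ n / √(1 - x²)` on `(-1, 1)` (the case `p = T_n` of (2.69)).
[cite: Rivlin1974, Ex. 2.7.5 (2.104); Sect. 2.7.4 (2.69)] -/
theorem abs_derivative_T_eval_le_div_sqrt (n : ℕ) {x : ℝ} (hx : x ∈ Set.Ioo (-1 : ℝ) 1) :
    |(derivative (T ℝ n)).eval x| ≤ n / Real.sqrt (1 - x ^ 2) := by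
  have hpos : 0 < 1 - x ^ 2 := by nlinarith [hx.1, hx.2]
  have h := one_sub_sq_mul_derivative_T_eval_sq_le n (Set.Ioo_subset_Icc_self hx)
  rw [le_div_iff₀ (Real.sqrt_pos.2 hpos), ← Real.sqrt_sq_eq_abs, ← Real.sqrt_mul (sq_nonneg _)]
  calc Real.sqrt (((derivative (T ℝ n)).eval x) ^ 2 * (1 - x ^ 2))
      ≤ Real.sqrt ((n : ℝ) ^ 2) := Real.sqrt_le_sqrt (by rw [mul_comm]; exact h)
    _ = n := Real.sqrt_sq (Nat.cast_nonneg n)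

/-- Ex. 2.7.5 (Lepson): `|T_n'(x)| < n / (2x)^{(n-1)/3}` for `0 < x < 1/2`, `n > 1`.
[cite: Rivlin1974, Ex. 2.7.5] -/
theorem abs_derivative_T_eval_lt {n : ℕ} (hn : 1 < n) {x : ℝ} (hx0 : 0 < x) (hx : x < 1 / 2) :
    |(derivative (T ℝ n)).eval x| < n / (2 * x) ^ (((n : ℝ) - 1) / 3) := by
  obtain ⟨k, rfl⟩ : ∃ k, n = k + 1 := ⟨n - 1, by omega⟩
  have hk : k ≠ 0 := by omega
  have ht0 : 0 < 2 * x := by positivity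
  have ht1 : 2 * x < 1 := by linarith
  have hU := abs_eval_U_half_lt_rpow hk ht0 ht1
  rw [mul_div_cancel_left₀ x two_ne_zero] at hU
  have hT : derivative (T ℝ ((k + 1 : ℕ) : ℤ)) = ((k : ℝ[X]) + 1) * U ℝ (k : ℤ) := by
    rw [T_derivative_eq_U]
    push_cast
    rw [add_sub_cancel_right]
  have hexp : (((k + 1 : ℕ) : ℝ) - 1) / 3 = (k : ℝ) / 3 := by
    push_cast
    ring
  have hev : |((k : ℝ[X]) + 1).eval x| = (k : ℝ) + 1 := by
    rw [eval_add, eval_natCast, eval_one]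
    exact abs_of_pos (by positivity)
  rw [neg_div] at hU
  rw [hT, eval_mul, abs_mul, hev, hexp, div_eq_mul_inv, ← rpow_neg ht0.le]
  push_cast
  exact mul_lt_mul_of_pos_left hU (by positivity)

end Literature.Analysis.Approximation.ExtrapolationLebesgueFunction
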